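import Summits.BirchSwinnertonDyer.BirchSwinnertonDyer.Theorems.SylvesterTwoHeegnerIndexLevelFixingTransportToFix
import Summits.BirchSwinnertonDyer.BirchSwinnertonDyer.Theorems.SylvesterTwoHeegnerIndexLevelFixingOrbitFormA
import HarnessLib

/-!
# (W2-b) `stub_levelFixingSeven` — FROM LEVEL TRANSPORT INTO THE `S₃`-SHEET TO THE FIXED POINT, ALL CLASSES
# (crux `UpperOffV0HSYPlus`, stmt-BirchSwinnertonDyer-19804; route `SylvesterTwoHeegnerIndex`, rung K7t)

Cell `bsd-cm`, seat `bsd-cm-k7t-w2b` g0.  Helper toward `stmt-BirchSwinnertonDyer-19804` (`--supports … --as helper`).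
THEOREMS ONLY (no definition, no named fact, no instance, no `sorry`).  Sequel of k7t-c2 g32's
`…LevelFixingTransportToFix.lean` (p749244: P1 `map_φ_eq_self_of_levelTransport`, P3 `pointGalHom_eq_self_of_forall_ringEquiv`,
and the W-class reduction `levelFixing_of_levelTransport_fricke` with the binder `hW`) and of this seat's orbit-form files
`…LevelFixingOrbitFormTransform.lean` / `…LevelFixingOrbitFormA.lean` (the partners on all three sheets `W, AW, A²W`).

* ★ `levelFixing_of_levelTransport_orbit` — THE STUB REDUCED TO ONE TRANSPORT HYPOTHESIS, ANY SHEET: under the stub's binders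
  (`p ≡ 1 (mod 3)` suffices), for a datum `Dt` with `IsS3Invariant Dt` ((G3) = HSY Prop. 2.1 (1), k-ty1's named fact
  `phi_s3Invariant_of_deg_eq_six` gives it for every degree-`6` datum), ANY `K`-automorphism `φ` of `K[9pn]`, ANY level-`243`
  Heegner form `Q′` of discriminant `(9pn)²·(−3)` whose CM point is `g • τ_n` for some `g ∈ ⟨w₂₄₃, A⟩ ≤ GL₂(ℚ)`:
  IF every `σ ∈ Aut(ℂ)` extending `φ` has `LevelTransport 243 σ τ_n (heegnerTau Q′)` THEN `φ` fixes every `y ∈ E₉(K[9pn])`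
  over `Dt.φ(τ_n)`.  Proof: P3 ∘ P1 with `Dt.φ(τ_{Q′}) = Dt.φ(g • τ_n) = Dt.φ(τ_n)` (`IsS3Invariant.smul_of_mem_closure`).
* ★ `levelFixing_of_levelTransport_sheet` — the same with the sheet supplied by `orbitForm_sylvesterTower` (`p ≡ 7 (mod 9)`):
  the transport hypothesis is stated against the tabulated partner `Q′` (`∃ i < 3, ∃ Q′ …` with the transport), so that a
  CM-side theorem producing `LevelTransport 243 σ τ_n (heegnerTau Q′)` for the decomposition involution (HSY Thm 2.3 = (R1);
  the name-free (4.2) via (G2) + the class identity `[Q′] = η*·[Q_n]` + the engine) closes the stub on ALL classes by one call.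

HONEST LABEL: CONDITIONAL (displayed `hLT`, `hS3`); no stub closed; nothing asserted on 19804; X12.CMAtTwo NOT proved; BSD is
proved for no curve.

## References
* Y. Hu, J. Shu, H. Yin, *An explicit Gross–Zagier formula related to the Sylvester conjecture*, Trans. AMS 372 (2019) =
  arXiv:1708.05266, §2.1 Prop. 2.1 (1), §2.2 Thm 2.2–2.3, §4.1. [HuShuYin2019]
* H. Darmon, *Rational Points on Modular Elliptic Curves*, CBMS 101 (2004), Thm. 3.6–3.7. [Darmon2004]
* B. H. Gross, *Heegner points on `X₀(N)`* (1984), §I.1, §5. [Gross1984]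
-/

set_option autoImplicit false
-- the Summit-side namespace `Summit.BirchSwinnertonDyer.BirchSwinnertonDyer.…` (summit = problem) is mandated by D-0017
set_option linter.dupNamespace false

noncomputable section

open scoped MatrixGroups

namespace Summit.BirchSwinnertonDyer.BirchSwinnertonDyer.Theorems.SylvesterTwoLevelFixingGlueOrbit

open Literature.NumberTheory.EllipticCurves Literature.NumberTheory.EllipticCurves.HeegnerForm
  Literature.NumberTheory.EllipticCurves.HuShuYin2019 Literature.NumberTheory.EllipticCurves.ModularForms
  Literature.FieldTheory.AlgClosed WeierstrassCurve
  Summit.BirchSwinnertonDyer.BirchSwinnertonDyer.Theorems.SylvesterTwoLevelFixingGlue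
  Summit.BirchSwinnertonDyer.BirchSwinnertonDyer.Theorems.SylvesterTwoLevelFixingOrbitA

variable {K : Type} [Field K] [NumberField K]

/-- `√((9pn)²·(−3)) = 9pn · √(−3)` (private helper, as in the W-class file). [folklore] -/
private theorem sqrtDisc_sylvester' (p n : ℕ) :
    sqrtDisc (((9 * p * n : ℕ) : ℤ) ^ 2 * (-3)) = ((9 * p * n : ℕ) : ℂ) * sqrtDisc (-3) := by
  unfold sqrtDisc
  have hm : (0 : ℝ) ≤ ((9 * p * n : ℕ) : ℝ) := Nat.cast_nonneg _
  have h : -((((9 * p * n : ℕ) : ℤ) ^ 2 * (-3) : ℤ) : ℝ) = (((9 * p * n : ℕ) : ℝ)) ^ 2 * (-((-3 : ℤ) : ℝ)) := by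
    push_cast; ring
  rw [h, Real.sqrt_mul (sq_nonneg _), Real.sqrt_sq hm]
  push_cast
  ring

/-- ★ **(W2-b) REDUCED TO ONE TRANSPORT HYPOTHESIS — ANY SHEET OF THE `S₃`-ORBIT.**  Binders as in `stub_levelFixingSeven`
(`p ≡ 1 (mod 3)` suffices for the implication), `K ∋ ω`, `[K:ℚ] = 2`, `ι`, `n ≠ 0` with all prime factors `≡ 2 (mod 3)`, a datum
`Dt : ModularParametrizationData ⟨0,0,1,0,−1⟩ 243` with `IsS3Invariant Dt` (`hS3`, (G3)), ANY `K`-automorphism `φ` of `K[9pn]`, a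
level-`243` Heegner form `Q′` of discriminant `(9pn)²·(−3)` (`hQ'`) whose CM point is `g • τ_n` for some `g` in the subgroup of
`GL₂(ℚ)` generated by `w₂₄₃` and `A` (`hg`, `hτ`), and a point `y ∈ E₉(K[9pn])` over `Dt.φ(τ_n)`.  HYPOTHESIS DISPLAYED: `hLT` —
every automorphism `σ` of `ℂ` extending `φ` has `LevelTransport 243 σ τ_n (heegnerTau Q′)`.  CONCLUSION: the stub's,
`pointGalHom E₉ K[9pn] (φ.restrictScalars ℚ) y = y`.  With `(g, Q′) = (w₂₄₃, fricke 243 Q_n)` this is the W-class file's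
`levelFixing_of_levelTransport_fricke`; with `(A·w₂₄₃, Q_n^{AW})`, `(A²·w₂₄₃, Q_n^{A²W})` (`orbitForm_AW_sylvesterTower`,
`orbitForm_AsqW_sylvesterTower`) it is the reduction on the classes `p ≡ 7, 16 (mod 27)`.  CONDITIONAL (`hLT`, `hS3`); no stub
closed; BSD is not proved by any of this. [cite: HuShuYin2019, §2.1 Prop. 2.1 (1), §2.2 Thm 2.3, §4.1] [cite: Darmon2004, Thm. 3.6–3.7]
[cite: Gross1984, §I.1, §5] -/
theorem levelFixing_of_levelTransport_orbit
    (Dt : ModularParametrizationData (⟨0, 0, 1, 0, -1⟩ : WeierstrassCurve ℚ) 243) (hS3 : IsS3Invariant Dt)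
    {p : ℕ} (hp3 : p % 3 = 1) {ω : K} (hω : ω ^ 2 + ω + 1 = 0) (h2 : Module.finrank ℚ K = 2)
    (ι : K →+* ℂ) {n : ℕ} (hn : n ≠ 0) (hprimes : ∀ q ∈ n.primeFactors, q % 3 = 2)
    (φ : ringClassField K ι (9 * p * n) ≃ₐ[K] ringClassField K ι (9 * p * n))
    {Q' : ℤ × ℤ × ℤ} (hQ' : Q' ∈ heegnerForms 243 (((9 * p * n : ℕ) : ℤ) ^ 2 * (-3)))
    {g : GL (Fin 2) ℚ} (hg : g ∈ Subgroup.closure ({(frickeGL 243 : GL (Fin 2) ℚ), hsyA} : Set (GL (Fin 2) ℚ)))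
    (hτ : heegnerTau Q' = glCast g •
      heegnerTau ((n : ℤ) ^ 2 * (81 * ((p : ℤ) ^ 2 + 4 * p + 16)),
        (n : ℤ) * (-(9 * (4 * (p : ℤ) ^ 2 + 17 * p + 72))), 4 * (p : ℤ) ^ 2 + 18 * p + 81))
    (hLT : ∀ σ : ℂ ≃+* ℂ, (∀ x : ringClassField K ι (9 * p * n), σ x = ((φ x : ringClassField K ι (9 * p * n)) : ℂ)) →
      LevelTransport 243 σ
        (heegnerTau ((n : ℤ) ^ 2 * (81 * ((p : ℤ) ^ 2 + 4 * p + 16)),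
          (n : ℤ) * (-(9 * (4 * (p : ℤ) ^ 2 + 17 * p + 72))), 4 * (p : ℤ) ^ 2 + 18 * p + 81))
        (heegnerTau Q'))
    (y : (((⟨0, 0, 1, 0, -1⟩ : WeierstrassCurve ℚ)).baseChange (ringClassField K ι (9 * p * n))).toAffine.Point)
    (hy : Affine.Point.map (W' := (⟨0, 0, 1, 0, -1⟩ : WeierstrassCurve ℚ))
        (ringClassField K ι (9 * p * n)).subtype.toRatAlgHom y =
      Dt.φ (heegnerTau ((n : ℤ) ^ 2 * (81 * ((p : ℤ) ^ 2 + 4 * p + 16)),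
        (n : ℤ) * (-(9 * (4 * (p : ℤ) ^ 2 + 17 * p + 72))), 4 * (p : ℤ) ^ 2 + 18 * p + 81))) :
    pointGalHom (⟨0, 0, 1, 0, -1⟩ : WeierstrassCurve ℚ) (ringClassField K ι (9 * p * n)) (φ.restrictScalars ℚ) y = y := by
  have hK : IsImaginaryQuadratic K := JZero.isImaginaryQuadratic_of_sq_add_self_add_one hω h2
  have hdK : NumberField.discr K = -3 := JZero.discr_eq_neg_three_of_sq_add_self_add_one hω h2
  have hp0 : 0 < p := by omega
  have hm : 9 * p * n ≠ 0 := Nat.mul_ne_zero (Nat.mul_ne_zero (by norm_num) hp0.ne') hn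
  have hnC := isCoprime_C_of_forall_prime_mod_three_eq_two (p := p) hn hprimes
  have hQ := sylvesterForm_mem_heegnerForms hp3 hn hnC
  -- `Dt.φ` takes the same value at the CM point of the partner (`S₃`-invariance)
  have hφ' : Dt.φ (heegnerTau Q') =
      Dt.φ (heegnerTau ((n : ℤ) ^ 2 * (81 * ((p : ℤ) ^ 2 + 4 * p + 16)),
        (n : ℤ) * (-(9 * (4 * (p : ℤ) ^ 2 + 17 * p + 72))), 4 * (p : ℤ) ^ 2 + 18 * p + 81)) := by
    rw [hτ, hS3.smul_of_mem_closure hg]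
  refine pointGalHom_eq_self_of_forall_ringEquiv hK ι hm _ φ y fun σ hσ ↦ ?_
  -- `σ` fixes `ι(K)`, hence `√((9pn)²·(−3))`
  have hσK : ∀ k : K, σ (ι k) = ι k := ringEquiv_apply_eq_of_extends ι (9 * p * n) φ hσ
  have hσD : σ (sqrtDisc (((9 * p * n : ℕ) : ℤ) ^ 2 * (-3))) = sqrtDisc (((9 * p * n : ℕ) : ℤ) ^ 2 * (-3)) := by
    have h3 : σ (sqrtDisc (-3)) = sqrtDisc (-3) := by
      have h := apply_sqrtDisc_discr_eq hK ι hσK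
      rwa [hdK] at h
    rw [sqrtDisc_sylvester', map_mul, map_natCast, h3]
  rw [hy]
  exact map_φ_eq_self_of_levelTransport Dt hσD hQ hQ' (hLT σ hσ) hφ'

/-- ★ **(W2-b) REDUCED TO ONE TRANSPORT HYPOTHESIS AGAINST THE TABULATED SHEET, ALL CLASSES of `p ≡ 7 (mod 9)`.**  Same as
`levelFixing_of_levelTransport_orbit`, with the partner taken from `orbitForm_sylvesterTower`: the displayed hypothesis `hLT` asks,
for SOME `i < 3` and SOME level-`243` Heegner form `Q′` of discriminant `(9pn)²·(−3)` with the residue of `Q_n` and CM point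
`(Aⁱ·w₂₄₃) • τ_n` (such exist on every class, `orbitForm_sylvesterTower`), that every `σ ∈ Aut(ℂ)` extending `φ` transports the
level-`243` structure of `τ_n` to that of `τ_{Q′}` — which is what HSY Thm 2.3 + the kernel certificate p748342 assert for the
decomposition involution at `w = (√−3)` on EVERY class, and what the name-free route (4.2) is to produce.  CONDITIONAL (`hLT`,
`hS3`); no stub closed; BSD is not proved by any of this. [cite: HuShuYin2019, §2.1 Prop. 2.1 (1), §2.2 Thm 2.3, §4.1]
[cite: Gross1984, §I.1, §5] -/
theorem levelFixing_of_levelTransport_sheet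
    (Dt : ModularParametrizationData (⟨0, 0, 1, 0, -1⟩ : WeierstrassCurve ℚ) 243) (hS3 : IsS3Invariant Dt)
    {p : ℕ} (hp3 : p % 3 = 1) {ω : K} (hω : ω ^ 2 + ω + 1 = 0) (h2 : Module.finrank ℚ K = 2)
    (ι : K →+* ℂ) {n : ℕ} (hn : n ≠ 0) (hprimes : ∀ q ∈ n.primeFactors, q % 3 = 2)
    (φ : ringClassField K ι (9 * p * n) ≃ₐ[K] ringClassField K ι (9 * p * n))
    (hLT : ∃ i : ℕ, i < 3 ∧ ∃ Q' ∈ heegnerForms 243 (((9 * p * n : ℕ) : ℤ) ^ 2 * (-3)),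
      heegnerTau Q' = glCast (hsyA ^ i * (frickeGL 243 : GL (Fin 2) ℚ)) •
        heegnerTau ((n : ℤ) ^ 2 * (81 * ((p : ℤ) ^ 2 + 4 * p + 16)),
          (n : ℤ) * (-(9 * (4 * (p : ℤ) ^ 2 + 17 * p + 72))), 4 * (p : ℤ) ^ 2 + 18 * p + 81) ∧
      ∀ σ : ℂ ≃+* ℂ, (∀ x : ringClassField K ι (9 * p * n), σ x = ((φ x : ringClassField K ι (9 * p * n)) : ℂ)) →
        LevelTransport 243 σ
          (heegnerTau ((n : ℤ) ^ 2 * (81 * ((p : ℤ) ^ 2 + 4 * p + 16)),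
            (n : ℤ) * (-(9 * (4 * (p : ℤ) ^ 2 + 17 * p + 72))), 4 * (p : ℤ) ^ 2 + 18 * p + 81))
          (heegnerTau Q'))
    (y : (((⟨0, 0, 1, 0, -1⟩ : WeierstrassCurve ℚ)).baseChange (ringClassField K ι (9 * p * n))).toAffine.Point)
    (hy : Affine.Point.map (W' := (⟨0, 0, 1, 0, -1⟩ : WeierstrassCurve ℚ))
        (ringClassField K ι (9 * p * n)).subtype.toRatAlgHom y =
      Dt.φ (heegnerTau ((n : ℤ) ^ 2 * (81 * ((p : ℤ) ^ 2 + 4 * p + 16)),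
        (n : ℤ) * (-(9 * (4 * (p : ℤ) ^ 2 + 17 * p + 72))), 4 * (p : ℤ) ^ 2 + 18 * p + 81))) :
    pointGalHom (⟨0, 0, 1, 0, -1⟩ : WeierstrassCurve ℚ) (ringClassField K ι (9 * p * n)) (φ.restrictScalars ℚ) y = y := by
  obtain ⟨i, -, Q', hQ', hτ, hT⟩ := hLT
  have hg : hsyA ^ i * (frickeGL 243 : GL (Fin 2) ℚ) ∈
      Subgroup.closure ({(frickeGL 243 : GL (Fin 2) ℚ), hsyA} : Set (GL (Fin 2) ℚ)) :=
    Subgroup.mul_mem _ (Subgroup.pow_mem _ (Subgroup.subset_closure (by simp)) i) (Subgroup.subset_closure (by simp))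
  exact levelFixing_of_levelTransport_orbit Dt hS3 hp3 hω h2 ι hn hprimes φ hQ' hg hτ hT y hy

end Summit.BirchSwinnertonDyer.BirchSwinnertonDyer.Theorems.SylvesterTwoLevelFixingGlueOrbit

end
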